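import Literature.MathematicalPhysics.QuantumFieldTheory.Balaban1983to89.Node00.TorusCoverLandau153TestForm
import Literature.MathematicalPhysics.QuantumFieldTheory.Balaban1983to89.Node00.TorusCoverBoxStencils

/-!
# NODE 00 — THE TWO-WINDOW PUSH-DOWN: the six clauses of [Balaban1985Variational] (152)–(153) on a small window `X ⊆ □`, with the identification
# `A ⟨π x, μ⟩ = A′ x μ` of the torus potential with its `ℤᵈ` lift on a LARGER cover-injective window `X′ ⊇ X` (up to the whole collared cube `□₀`), so that
# the (153) test-function form of `Node00.TorusCoverLandau153TestForm` is available for ALL gauge test functions of the cube tower (supported in `□₁ ⊋ □`)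

Cell `pub-ymgap`, width seat `pub-ymgap-dag-n07-w3` generation 2, INTENT-2 (2026-08-28).  NEW leaf, PROOF kind (no `def`, no `instance`, no `notation`).  CONSUMED BY NAME,
nothing modified: generation 0's `Node00.TorusCoverLandau153` (`exists_suGauge_letters152_153_of_gaugedBoundB8`) and `…Print` (`lap_cover_eq_covLap_of_window`), dag-n07-e's FILE P2
`Node00.TorusCoverLocalGaugePrint` (`codiffCurlA_cover_eq_pdiv_of_window`), FILES 25 ∕ 28b ∕ 34b (`zdLift`, `zdLift_mem_specialUnitaryUnits`, `cfgExp_eq_expI`, `cover_add_e`, `cover_sub_e`,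
`eq_of_cover_eq_of_mem_cubeExt`, `add_e_mem_cubeExt_of_shift_mem_image`, `sub_e_mem_cubeExt_of_unshift_mem_image`), dag-n07-w4's `Node00.TorusCoverBoxStencils`
(`Sect2.eq_of_cover_eq_of_inBox`), this seat's `Node00.TorusCoverLandau153TestForm` (`sum_laplace_mul_diverg_eq_zero_of_isLandau138_cover`), N05's `CubeB8` ∕ `GaugedBoundB8` ∕
`B8Eq131Cubes`.  `--kind proof --supports stmt-QuantumFields-20542` (K1⁷; count-neutral).  [15] = [Balaban1985Variational]; [6] = [Balaban1985RegularSpaces]; [B6] = [Balaban1984PropagatorsII].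

WHY.  Generation 0's window theorem identifies the torus potential `A` with its lift `A′` only on the window `X ⊆ box = □ = □_k` where the four (152) letters are extracted; but the
gauge test functions of [6] (1.38) ∕ [15] (153) for the cube tower `□₀ ⊋ □₁ ⊋ ⋯ ⊋ □_k = □` ((1.131); `N(Q′)`: zero on `Λ′₀ = □₀ ∖ □₁`, zero block means on `Λ′_j`) are supported
anywhere in `□₁ ⊋ □`, so the (153) test-function form of `…Landau153TestForm` (test functions two steps inside the identification window) needs the identification on a window
`X′` as large as `□₀`.  [6] Prop. 6 gives `u` and `A′` on all of `□̃ = □₀` ((1.135) «on □̃»); the push-down `u := s ∘ π⁻¹`, `A := A′ ∘ π⁻¹` is well defined on any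
cover-injective `X′`; the letter clauses are unchanged on `X ⊆ X′ ∩ □`.  THIS FILE: §1 the two-window push-down (generation 0's proof with `u`, `A` defined through `X′`);
§2 ★ the (153) test-function form for every test function two steps inside `π(X′)`, `X′ ⊆ □₀` — with `X′ := □₀` these are all test functions vanishing on the lift of
`Λ′₀` whose support keeps two steps from `∂□₀` (print's `Λ′₀` has width `ρLᵏ ≥ 2`).

HONEST FRAMING: bookkeeping under the cover (generation 0's construction verbatim with one more window); [6] Proposition 6 at the member is the HYPOTHESIS `hG`
(`GaugedBoundB8`); cover-injectivity of the big window is a displayed hypothesis (`hinj'`; for `X′ = □₀` it is the non-wrapping of the collared cube, dischargeable by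
dag-n07-w4's `Sect2.eq_of_cover_eq_of_inBox` at a datum whose collared side is `< 2L^{m+K}`); the identification of the test-function rows with `ker Q′` of a
`B6SectADomainsV1.Domains (F.P K)` family is NOT made here; nothing of [15] ∕ [6] ∕ [B6] analysis asserted; N07 ∕ N05 ∕ K0⁷ ∕ K1⁷ NOT closed or discharged; counts unmoved
(typed 28∕28 · discharged 5∕27); one finite 𝕋⁴ programme at fixed ε — R4 closes the conditional finite-𝕋⁴ rung `BalabanLadder.UV` only; the YM mass gap (Clay) is NOT proved
by any of this; nothing continuum ∕ ℝ⁴ ∕ infinite volume ∕ OS.  No `sorry`, no `def`, no `instance`, no `notation`.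
-/

noncomputable section

namespace Literature.MathematicalPhysics.QuantumFieldTheory.Balaban1983to89.Node00

open scoped Matrix.Norms.L2Operator
open Complex (I)
open B7Prop1Explicit (e e_apply)
open B7Prop1Local (InBox)
open B7Prop2Explicit (unitaryUnits mem_unitaryUnits)
open B7Prop2SpecialUnitary (specialUnitaryUnits mem_specialUnitaryUnits)
open B8Ineq132 (InAk)
open B8Eq131Cubes (box tcube bLo bHi)
open B8Eq184Proof (cfgExp)
open B8Eq146AExpansion (plaqCovDeriv)
open B8Eq143PlaqExpansion (pdiv)
open B8Eq138LandauZd (covLap IsLandau138)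
open B8Eq191FlatLettersCubeMember (cubeFam_zero_finite)
open B15Eq112TorusCover (cover)
open B14DomainGeom (Pt)
open B14.Eq213MaximalDomains (side cubeExt)
open B12RegularSpaces111 (gaugeU expI grad)
open LatticeFieldCalculus (laplace diverg)
open Literature.MathematicalPhysics.QuantumLattice (blockSites)

variable {P : Params} {N : ℕ} [NeZero N]

/-! ## §1  ★★ The six-clause push-down with the identification on a larger window -/

section TwoWindow

/-- ★★ **THE TWO-WINDOW PUSH-DOWN** — generation 0's `exists_localGauge152_153_window_of_gaugedBoundB8` (same hypotheses: `d ≥ 2`; a `CubeB8` datum `c` with `c.k = n`;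
`0 ≤ r`; `GaugedBoundB8 L η_n (zdLift N U) c r`; a step-closed window `X ⊆ box L c.a c.M c.k`; the `2π`-window) for a SECOND window `X′ ⊇ X` on which the cover `π` is
injective: the gauge `u` and the potential `A` are pushed down THROUGH `X′` (`u(π x) = s(x)`, `A ⟨π x, μ⟩ = A′(x, μ)` for `x ∈ X′`), the gauge equation and the four (152)
letters hold on `π(X)` exactly as before, and the sixth conjunct identifies `A` with the (153)-gauged lift `A′` (`IsLandau138 L c.k η_n □₀ c.lamS 1 A′`, N05's multiplier
form) on ALL of `X′`. [cite: Balaban1985Variational, (144)–(153) pp.300–301; Balaban1985RegularSpaces, Prop. 6 (1.135)–(1.138) p.99, (1.38) p.82; Balaban1987RG1, (0.1) p.251] -/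
theorem exists_localGauge152_153_window₂_of_gaugedBoundB8 (hd : 2 ≤ P.d) {K' : ℕ} {Ω' : ℕ → Set (B7Prop1Explicit.Site P.d)} (c : CubeB8 P.d P.L K' Ω')
    (U : GaugeField P 0 (SU N)) {n : ℕ} (hk : c.k = n) {r : ℝ} (hr : 0 ≤ r)
    (hG : letI : CStarAlgebra (MatA N) := {}; GaugedBoundB8 P.L (P.eta n) (zdLift N U) c r)
    {X X' : Set (Pt P.d)} (hXX' : X ⊆ X') (hinj' : Set.InjOn (cover P) X')
    (hfwd : ∀ ⦃x⦄, x ∈ X → ∀ μ, (cover P x).shift μ ∈ cover P '' X → x + e μ ∈ X)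
    (hbwd : ∀ ⦃x⦄, x ∈ X → ∀ ν, (cover P x).unshift ν ∈ cover P '' X → x - e ν ∈ X)
    (hbox : X ⊆ box P.L c.a c.M c.k)
    (h2π : (2 * boxWidth (bLo P.L c.a c.k 0) (bHi P.L c.a c.M c.k 0) + 1) * (P.eta n * N * (r * ((P.L : ℝ) ^ c.k * P.eta n)⁻¹)) < 2 * Real.pi) :
    ∃ u : GaugeTransf P 0 (SU N), ∃ A : PBond P 0 → MatA N,
      (∀ b ∈ (Sect2.regionOfSet P (cover P '' X)).bonds, gaugeU (fun x => ιSU N (u x)) (fun b' => ιSU N (U b')) b = expI (P.eta n) (A b)) ∧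
      (∀ b ∈ (Sect2.regionOfSet P (cover P '' X)).bonds, ‖A b‖ ≤ 2 * r) ∧
      (∀ q ∈ (Sect2.regionOfSet P (cover P '' X)).dpairs, ‖grad (P.eta n) q.2.1 (fun y => A ⟨y, q.2.2⟩) q.1‖ ≤ 2 * r) ∧
      (∀ b ∈ Sect2.bondsDeep (cover P '' X), ‖Sect2.codiffCurlA (P.eta n) A b.src b.dir‖ ≤ 2 * r) ∧
      (∀ b ∈ Sect2.bondsDeep (cover P '' X),
          ‖∑ ν : Fin P.d, ((P.eta n : ℝ) : ℂ)⁻¹ •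
              (grad (P.eta n) ν (fun y => A ⟨y, b.dir⟩) (b.src.unshift ν) - grad (P.eta n) ν (fun y => A ⟨y, b.dir⟩) b.src)‖ ≤ 2 * r) ∧
      ∃ A' : B7Prop1Explicit.Site P.d → Fin P.d → MatA N,
        (∀ x, x ∈ X' → ∀ μ, A ⟨cover P x, μ⟩ = A' x μ) ∧
        IsLandau138 P.L c.k (P.eta n) (c.sq 0) c.lamS (1 : B7Prop1Explicit.Site P.d → Fin P.d → (MatA N)ˣ) A' := by
  classical
  letI : CStarAlgebra (MatA N) := {}
  have hL : 2 ≤ P.L := P.hL.2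
  have hηpos : 0 < P.eta n := B3GkZeroTorusRescaled.eta_pos P n
  set V := zdLift N U with hV
  obtain ⟨s, A', h1, h2, h3, h4, h4', h5⟩ :=
    exists_suGauge_letters152_153_of_gaugedBoundB8 hd hL c V (zdLift_mem_specialUnitaryUnits U) hηpos hr hG h2π
  have hscale : (P.L : ℝ) ^ c.k * P.eta n = 1 := by rw [hk]; exact B12Eq115BackgroundPair.pow_mul_eta P n
  simp only [hscale, inv_one, mul_one, one_pow] at h2 h3 h4 h4'
  have hinj : Set.InjOn (cover P) X := hinj'.mono hXX'
  -- push-down through the cover, injective on the LARGE window `X′`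
  let u : GaugeTransf P 0 (SU N) := fun y =>
    if h : ∃ x, x ∈ X' ∧ cover P x = y then s (Classical.choose h) else 1
  let A : PBond P 0 → MatA N := fun b =>
    if h : ∃ x, x ∈ X' ∧ cover P x = b.src then A' (Classical.choose h) b.dir else 0
  have hu : ∀ x, x ∈ X' → u (cover P x) = s x := by
    intro x hx
    have hex : ∃ x', x' ∈ X' ∧ cover P x' = cover P x := ⟨x, hx, rfl⟩
    simp only [u, dif_pos hex]
    rw [hinj' (Classical.choose_spec hex).1 hx (Classical.choose_spec hex).2]
  have hA : ∀ x, x ∈ X' → ∀ μ, A ⟨cover P x, μ⟩ = A' x μ := by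
    intro x hx μ
    have hex : ∃ x', x' ∈ X' ∧ cover P x' = cover P x := ⟨x, hx, rfl⟩
    simp only [A, dif_pos hex]
    rw [hinj' (Classical.choose_spec hex).1 hx (Classical.choose_spec hex).2]
  have hlift : ∀ y, y ∈ cover P '' X → ∃ x, x ∈ X ∧ cover P x = y := fun y ⟨x, hx, hxy⟩ => ⟨x, hx, hxy⟩
  refine ⟨u, A, fun b hb => ?_, fun b hb => ?_, fun q hq => ?_, fun b hb => ?_, fun b hb => ?_, A', hA, h5⟩
  · obtain ⟨x, hx, hxs⟩ := hlift b.src hb.1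
    have hx' : x + e b.dir ∈ X := hfwd hx b.dir (by rw [hxs]; exact hb.2)
    have hb' : b = ⟨cover P x, b.dir⟩ := by cases b; simp only at hxs; rw [hxs]
    rw [hb', hA x (hXX' hx)]
    have hgauge := h1 x b.dir (hbox hx) (hbox hx')
    rw [cfgExp_eq_expI] at hgauge
    rw [← hgauge]
    simp only [gaugeU, B7Prop1Explicit.gaugeAct, PBond.tgt, ← cover_add_e, hu x (hXX' hx), hu (x + e b.dir) (hXX' hx'), hV, zdLift_apply]
  · obtain ⟨x, hx, hxs⟩ := hlift b.src hb.1
    have hx' : x + e b.dir ∈ X := hfwd hx b.dir (by rw [hxs]; exact hb.2)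
    have hb' : b = ⟨cover P x, b.dir⟩ := by cases b; simp only at hxs; rw [hxs]
    rw [hb', hA x (hXX' hx)]
    exact h2 x b.dir (hbox hx) (hbox hx')
  · obtain ⟨hq1, hq2, hq3, -⟩ := hq
    obtain ⟨x, hx, hxs⟩ := hlift q.1 hq1
    have hxμ : x + e q.2.1 ∈ X := hfwd hx q.2.1 (by rw [hxs]; exact hq2)
    have hxν : x + e q.2.2 ∈ X := hfwd hx q.2.2 (by rw [hxs]; exact hq3)
    rw [grad, ← hxs, ← cover_add_e, hA x (hXX' hx), hA (x + e q.2.1) (hXX' hxμ), norm_smul, norm_inv, Complex.norm_real, Real.norm_eq_abs,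
      abs_of_pos hηpos]
    calc (P.eta n)⁻¹ * ‖A' (x + e q.2.1) q.2.2 - A' x q.2.2‖ ≤ (P.eta n)⁻¹ * (2 * (P.eta n * r)) :=
          mul_le_mul_of_nonneg_left (h3 x q.2.1 q.2.2 (hbox hx) (hbox hxμ) (hbox hxν)) (inv_nonneg.2 hηpos.le)
      _ = 2 * r := by field_simp
  · obtain ⟨hb1, hb2, hbν⟩ := hb
    obtain ⟨x, hx, hxs⟩ := hlift b.src hb1
    have hxμ : x + e b.dir ∈ X := hfwd hx b.dir (by rw [hxs]; exact hb2)
    have hstencil : ∀ ν, x + e ν ∈ X ∧ x - e ν ∈ X ∧ x - e ν + e b.dir ∈ X := by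
      intro ν
      obtain ⟨s1, s2, s3, s4⟩ := hbν ν
      have hxν : x + e ν ∈ X := hfwd hx ν (by rw [hxs]; exact s1)
      have hxν' : x - e ν ∈ X := hbwd hx ν (by rw [hxs]; exact s2)
      have hxν'' : x - e ν + e b.dir ∈ X :=
        hfwd hxν' b.dir (by
          rw [cover_sub_e, hxs, ← Site.unshift_shift_comm]
          exact s4)
      exact ⟨hxν, hxν', hxν''⟩
    have hb' : b = ⟨cover P x, b.dir⟩ := by cases b; simp only at hxs; rw [hxs]
    rw [hb']
    show ‖Sect2.codiffCurlA (P.eta n) A (cover P x) b.dir‖ ≤ 2 * r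
    have hAX : ∀ z, z ∈ X → ∀ κ, A ⟨cover P z, κ⟩ = A' z κ := fun z hz => hA z (hXX' hz)
    rw [codiffCurlA_cover_eq_pdiv_of_window (P.eta n) hAX hx hxμ hstencil]
    exact h4 x b.dir (hbox hx) (hbox hxμ) fun ν => ⟨hbox (hstencil ν).1, hbox (hstencil ν).2.1, hbox (hstencil ν).2.2⟩
  · obtain ⟨hb1, hb2, hbν⟩ := hb
    obtain ⟨x, hx, hxs⟩ := hlift b.src hb1
    have hxμ : x + e b.dir ∈ X := hfwd hx b.dir (by rw [hxs]; exact hb2)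
    have hstencil : ∀ ν, x + e ν ∈ X ∧ x - e ν ∈ X := by
      intro ν
      obtain ⟨s1, s2, -, -⟩ := hbν ν
      exact ⟨hfwd hx ν (by rw [hxs]; exact s1), hbwd hx ν (by rw [hxs]; exact s2)⟩
    have hb' : b = ⟨cover P x, b.dir⟩ := by cases b; simp only at hxs; rw [hxs]
    rw [hb']
    show ‖∑ ν : Fin P.d, ((P.eta n : ℝ) : ℂ)⁻¹ •
        (grad (P.eta n) ν (fun y => A ⟨y, b.dir⟩) ((cover P x).unshift ν) - grad (P.eta n) ν (fun y => A ⟨y, b.dir⟩) (cover P x))‖ ≤ 2 * r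
    have hAX : ∀ z, z ∈ X → ∀ κ, A ⟨cover P z, κ⟩ = A' z κ := fun z hz => hA z (hXX' hz)
    rw [lap_cover_eq_covLap_of_window (P.eta n) hAX hx hstencil]
    exact h4' x b.dir (hbox hx) (hbox hxμ) fun ν => ⟨hbox (hstencil ν).1, hbox (hstencil ν).2⟩

end TwoWindow

/-! ## §2  ★ The (153) test-function form on the large window -/

section TestForm

omit [NeZero N] in
/-- ★ **(153) AT THE RECORD'S TORUS, TEST-FUNCTION FORM, ON THE LARGE WINDOW**: from the sixth conjunct of the two-window push-down (`∃ A′`, `A ⟨π x, μ⟩ = A′ x μ` on `X′` ∧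
`IsLandau138 L c.k η □₀ c.lamS 1 A′`) with `X′ ⊆ □₀ = c.sq 0` cover-injective, every torus test function `μ : T → ℂ` whose support lifts to a set `S` two steps inside `X′`,
vanishing on the lift of `Λ′₀ = c.lamS 0` and with vanishing lifted `Lʲ`-block sums on the blocks of `Λ′_j` (`1 ≤ j ≤ c.k`), and every `φ : M_N(ℂ) →L[ℂ] ℂ`:
`Σ_y (laplace η⁻¹ μ)(y)·φ((diverg η⁻¹ A)(y)) = 0` — [B6] (2.12) «⟨Δμ, ∂*A⟩ = 0, μ ∈ N(Q′)» for ALL of the cube tower's test functions once `X′ = □₀` (their supports lie in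
`□₁`, two steps inside `□₀`).  (`Node00.TorusCoverLandau153TestForm.sum_laplace_mul_diverg_eq_zero_of_isLandau138_cover` at `Ω₀ := □₀`, `X := X′`.)
[cite: Balaban1985Variational, (153) p.301, p.302; Balaban1985RegularSpaces, (1.38) p.82, (1.131) p.99; Balaban1984PropagatorsII, (2.7) p.224, (2.10)–(2.12) p.225] -/
theorem sum_laplace_mul_diverg_eq_zero_of_window₂153 {K' : ℕ} {Ω' : ℕ → Set (B7Prop1Explicit.Site P.d)} (c : CubeB8 P.d P.L K' Ω')
    {η : ℝ} {X' : Set (Pt P.d)} (hX' : X' ⊆ c.sq 0) (hinj' : Set.InjOn (cover P) X')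
    {A : PBond P 0 → MatA N}
    (h6 : ∃ A' : B7Prop1Explicit.Site P.d → Fin P.d → MatA N,
        (∀ x, x ∈ X' → ∀ μ, A ⟨cover P x, μ⟩ = A' x μ) ∧
        IsLandau138 P.L c.k η (c.sq 0) c.lamS (1 : B7Prop1Explicit.Site P.d → Fin P.d → (MatA N)ˣ) A')
    {μ : Site P 0 → ℂ} {S : Set (Pt P.d)} (hμS : ∀ y, μ y ≠ 0 → y ∈ cover P '' S)
    (hS : ∀ s ∈ S, ∀ z : Pt P.d, (∀ i, |z i - s i| ≤ 2) → z ∈ X')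
    (h0 : ∀ x ∈ X', x ∈ c.lamS 0 → μ (cover P x) = 0)
    (hQ : ∀ j, 1 ≤ j → j ≤ c.k → ∀ y ∈ c.lamS j, ∑ x ∈ blockSites (P.L ^ j) y, X'.indicator (fun z => μ (cover P z)) x = 0)
    (φ : MatA N →L[ℂ] ℂ) :
    ∑ y : Site P 0, laplace η⁻¹ μ y * φ (diverg η⁻¹ A y) = 0 := by
  obtain ⟨A', hA, hLan⟩ := h6
  exact sum_laplace_mul_diverg_eq_zero_of_isLandau138_cover P.L_pos (cubeFam_zero_finite P.L c.a c.M c.ρ c.k) hLan hX' hinj' hA hμS hS h0 hQ φ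

omit [NeZero N] in
/-- `□₀` does not wrap ⇒ the cover is injective on it: the collared cube `□₀ = c.sq 0` is the integer box `[tlo, thi]` of `B8Eq131Cubes.cube … 0`; if its sides are
`< 2L^{m+K}` (`hw`, in dag-n07-w4's letters) then `π` is injective on `□₀` (`Sect2.eq_of_cover_eq_of_inBox`). [cite: Balaban1985RegularSpaces, p.98 («a cube which we denote by □̃»); Balaban1987RG1, (0.1) p.251] -/
theorem injOn_cover_sq_zero {K' : ℕ} {Ω' : ℕ → Set (B7Prop1Explicit.Site P.d)} (c : CubeB8 P.d P.L K' Ω')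
    (hw : ∀ i, B8Ineq130.thi P.L (B8Eq131Cubes.sqHi P.L c.a c.M c.ρ c.k 0) 0 i -
        B8Ineq130.tlo P.L (B8Eq131Cubes.sqLo P.L c.a c.ρ c.k 0) 0 i + 1 ≤ P.sitesPerDir 0) :
    Set.InjOn (cover P) (c.sq 0) := by
  intro x hx x' hx' h
  rw [show c.sq 0 = _ from B8Eq131CubesAdmissible.cubeFam_false_zero P.L c.a c.M c.ρ c.k] at hx hx'
  exact Sect2.eq_of_cover_eq_of_inBox hw hx hx' h

end TestForm

#print axioms exists_localGauge152_153_window₂_of_gaugedBoundB8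

end Literature.MathematicalPhysics.QuantumFieldTheory.Balaban1983to89.Node00

end
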